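import Literature.NumberTheory.Automorphic.WhittakerTower
import Literature.NumberTheory.Automorphic.ArchFlowParametricIntegral
import HarnessLib

/-!
# Differentiating the Whittaker tower along archimedean one-parameter subgroups

Topic `NumberTheory/Automorphic`; namespace `Literature.NumberTheory.Automorphic`. Sequel of
`WhittakerTower` (the column transforms `T_c f (g) = μ(box)⁻¹ ∫_{box} f(y g) conj ψ(y_{c-1,c}) dy`
along the column groups `Y_c(𝔸_K)` and the partial Whittaker transforms
`Φ_d = T_{d+1} ⋯ T_{n-1} φ`, `Φ_0 = W_φ`) and of `ArchFlowParametricIntegral` (differentiation of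
parametric integrals along the flows `t ↦ g · ι(exp tX)` of an archimedean one-parameter subgroup,
`ι : H → GL_n(𝔸_K)` a continuous homomorphism from a linear real group `H`). We PROVE that the
column transforms, hence all the `Φ_d` and the global Whittaker function `W_φ = Φ_0`, may be
differentiated under the integral sign along such flows — the step "`W_{Xφ} = X W_φ`, since the
integral defining `W_φ` is over a compact set" of every estimate of Whittaker functions by the
derivatives of the form (Moeglin–Waldspurger (1995), I.2.10–I.2.11, integration by parts over the
compact quotients `V_{i-1}(𝔸)V_i(k)\V_i(𝔸)`; Cogdell (2004), §1.1, proof of Thm. 1.1: the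
convergence estimates "since `φ` is smooth"):

* `norm_colTransform_le`, `norm_whittakerDepth_le` — `‖T_c f‖_∞ ≤ ‖f‖_∞`, `‖Φ_d‖_∞ ≤ ‖φ‖_∞`
  (normalised averages against a unitary character);
* `hasDerivAt_colTransform_flow` — if `f, f'` are continuous and `d/dt f(z ι(exp tX))|₀ = f' z` for
  all `z`, then `d/dt (T_c f)(g ι(exp tX)) = (T_c f')(g ι(exp tX))` (dominated differentiation on
  the Tate box, which has compact closure and finite measure);
* `hasDerivAt_whittakerDepth_flow`, `lieDeriv_whittakerDepth` — the same for every `Φ_d`, hence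
  `X Φ_d(φ) = Φ_d(φ')`;
* `iterLieDeriv_whittakerDepth` — `(X₁ ⋯ X_k) Φ_d(φ) = Φ_d((X₁ ⋯ X_k) φ)` for `φ` all of whose
  iterated Lie derivatives are archimedean-smooth and continuous;
* `iteratedDeriv_whittakerDepth_flow` — `(d/ds)^k Φ_d(φ)(g ι(exp sY))|₀ = Φ_d(Y^k φ)(g)`.

Everything here is proved; no definitions are introduced.

## References

* C. Moeglin, J.-L. Waldspurger, *Spectral decomposition and Eisenstein series* (1995), I.2.10,
  I.2.11 [MoeglinWaldspurger1995].
* J. W. Cogdell, *Analytic theory of L-functions for GL_n*, in *An Introduction to the Langlands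
  Program* (2004), §1.1, Thm. 1.1 [CogdellAnalyticTheory2004].
-/

noncomputable section

open MeasureTheory Measure NumberField IsDedekindDomain Matrix Set Filter Topology Metric
open scoped MatrixGroups ENNReal NNReal ComplexConjugate

namespace Literature.NumberTheory.Automorphic

section Transform

variable {n : ℕ} {K : Type} [Field K] [NumberField K]
variable [MeasurableSpace (GL (Fin n) (AdeleRing (𝓞 K) K))] [BorelSpace (GL (Fin n) (AdeleRing (𝓞 K) K))]

/-! ### Sup-norm bounds -/

/-- **`‖T_c f (g)‖ ≤ M` if `‖f‖ ≤ M` everywhere** (the column transform is a normalised average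
against a character of modulus one). [folklore] -/
theorem norm_colTransform_le (c : ℕ) (hc : c < n) (hc0 : 0 < c)
    {f : GL (Fin n) (AdeleRing (𝓞 K) K) → ℂ} {M : ℝ} (hM : ∀ z, ‖f z‖ ≤ M)
    (g : GL (Fin n) (AdeleRing (𝓞 K) K)) :
    ‖colTransform (K := K) c hc hc0 f g‖ ≤ M := by
  set Y := adelicColRange n K c c
  set μ : Measure ↥Y := Measure.haar with hμ
  set box := colRangeTateDomain n K c c with hbox
  have hM0 : 0 ≤ M := (norm_nonneg _).trans (hM 1)
  have hboxfin : μ box < ⊤ := measure_colRangeTateDomain_lt_top μ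
  have hint : ‖∫ y in box, colIntegrand c hc hc0 f g y ∂μ‖ ≤ M * (μ box).toReal := by
    refine norm_setIntegral_le_of_norm_le_const hboxfin fun y _ => ?_
    unfold colIntegrand
    rw [norm_mul, norm_colCharFactor c hc hc0, mul_one]
    exact hM _
  rw [colTransform_eq, norm_smul, norm_inv, Real.norm_of_nonneg ENNReal.toReal_nonneg]
  rcases eq_or_ne (μ box).toReal 0 with h0 | h0
  · rw [h0, _root_.inv_zero, zero_mul]; exact hM0
  · calc (μ box).toReal⁻¹ * ‖∫ y in box, colIntegrand c hc hc0 f g y ∂μ‖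
        ≤ (μ box).toReal⁻¹ * (M * (μ box).toReal) :=
          mul_le_mul_of_nonneg_left hint (inv_nonneg.2 ENNReal.toReal_nonneg)
      _ = M := by field_simp

/-- **`‖whittakerIter k φ (g)‖ ≤ M` if `‖φ‖ ≤ M` everywhere.** [folklore] -/
theorem norm_whittakerIter_le {φ : GL (Fin n) (AdeleRing (𝓞 K) K) → ℂ} {M : ℝ} (hM : ∀ z, ‖φ z‖ ≤ M) :
    ∀ (k : ℕ) (g : GL (Fin n) (AdeleRing (𝓞 K) K)), ‖whittakerIter (K := K) k φ g‖ ≤ M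
  | 0, g => hM g
  | k + 1, g => by
    by_cases h : n - (k + 1) < n ∧ 0 < n - (k + 1)
    · have : whittakerIter (K := K) (k + 1) φ g = colTransform (n - (k + 1)) h.1 h.2 (whittakerIter k φ) g := by
        simp only [whittakerIter, dif_pos h]
      rw [this]
      exact norm_colTransform_le _ h.1 h.2 (fun z => norm_whittakerIter_le hM k z) g
    · have : whittakerIter (K := K) (k + 1) φ g = whittakerIter k φ g := by
        simp only [whittakerIter, dif_neg h]
      rw [this]
      exact norm_whittakerIter_le hM k g

/-- **`‖Φ_d(g)‖ ≤ M` if `‖φ‖ ≤ M` everywhere** (`Φ_d = whittakerDepth d φ`). [folklore] -/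
theorem norm_whittakerDepth_le {φ : GL (Fin n) (AdeleRing (𝓞 K) K) → ℂ} {M : ℝ} (hM : ∀ z, ‖φ z‖ ≤ M)
    (d : ℕ) (g : GL (Fin n) (AdeleRing (𝓞 K) K)) : ‖whittakerDepth (K := K) d φ g‖ ≤ M :=
  norm_whittakerIter_le hM _ g

/-! ### Differentiation under the column transform along an archimedean flow -/

variable {A : Type*} [NormedCommRing A] [NormedAlgebra ℝ A] [NormedAlgebra ℚ A] [CompleteSpace A]
  [StarRing A] {N : Type*} [Fintype N] [DecidableEq N] {H : RealMatrixGroup A N}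
  (ι : H.carrier →* GL (Fin n) (AdeleRing (𝓞 K) K))

/-- `exp (0 · X) = 1` in `H` (local copy). [folklore] -/
private theorem expMem_zero_smul'' (X : H.lie) : H.expMem ((0 : ℝ) • X) = 1 := by
  refine Subtype.ext ?_
  change expGL (((0 : ℝ) • X : H.lie) : Matrix N N A) = 1
  have h0 : (((0 : ℝ) • X : H.lie) : Matrix N N A) = 0 := by
    change (0 : ℝ) • (X : Matrix N N A) = 0
    exact zero_smul _ _
  rw [h0, expGL_zero]

variable (hι : Continuous ι)
include hι

/-- **Differentiation under the column transform along an archimedean flow.** Let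
`ι : H → GL_n(𝔸_K)` be continuous, `X ∈ 𝔤`, and let `f, f'` be continuous with
`d/dt f(z ι(exp tX))|_{t=0} = f'(z)` for every `z`. Then for every `g` and `s`,
`d/dt (T_c f)(g ι(exp tX))|_{t=s} = (T_c f')(g ι(exp sX))`: dominated differentiation of
`∫_{box} f(y g ι(exp tX)) conj ψ(y_{c-1,c}) dy`, the derivatives being bounded on the compact set
`closure(box) · g · ι(exp [s-1,s+1] X)`. This is the differentiation under the integral over the
compact unipotent quotient in Moeglin–Waldspurger's I.2.10. [cite: MoeglinWaldspurger1995, I.2.10] -/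
theorem hasDerivAt_colTransform_flow (c : ℕ) (hc : c < n) (hc0 : 0 < c) (X : H.lie)
    {f f' : GL (Fin n) (AdeleRing (𝓞 K) K) → ℂ} (hf : Continuous f) (hf' : Continuous f')
    (hflow : ∀ z, HasDerivAt (fun t : ℝ => f (z * ι (H.expMem (t • X)))) (f' z) 0)
    (g : GL (Fin n) (AdeleRing (𝓞 K) K)) (s : ℝ) :
    HasDerivAt (fun t : ℝ => colTransform (K := K) c hc hc0 f (g * ι (H.expMem (t • X))))
      (colTransform (K := K) c hc hc0 f' (g * ι (H.expMem (s • X)))) s := by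
  haveI := AdelicGroupData.locallyCompactSpace_generalLinearGroup_adeleRing K (Fin n)
  haveI := secondCountableTopology_generalLinearGroup_adeleRing K (Fin n)
  set Y := adelicColRange n K c c
  set μ : Measure ↥Y := Measure.haar with hμ
  set box := colRangeTateDomain n K c c with hbox
  have hboxm : MeasurableSet box := measurableSet_colRangeTateDomain
  have hboxfin : μ box < ⊤ := measure_colRangeTateDomain_lt_top μ
  haveI : IsFiniteMeasure (μ.restrict box) := isFiniteMeasure_restrict.2 hboxfin.ne
  -- the character factor
  obtain ⟨χ, hχ⟩ : ∃ χ : ↥Y → ℂ, χ = fun y : ↥Y =>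
      (conj (adeleAddChar K ((((y : ↥Y) : GL (Fin n) (AdeleRing (𝓞 K) K)) : Matrix (Fin n) (Fin n) (AdeleRing (𝓞 K) K))
        ⟨c - 1, by omega⟩ ⟨c, hc⟩) : ℂ) : ℂ) := ⟨_, rfl⟩
  have hχc : Continuous χ := by rw [hχ]; exact continuous_colCharFactor c hc hc0
  -- the flow and its continuity
  obtain ⟨γ, hγ⟩ : ∃ γ : ℝ → GL (Fin n) (AdeleRing (𝓞 K) K), γ = fun t => g * ι (H.expMem (t • X)) :=
    ⟨_, rfl⟩
  have hγc : Continuous γ := by rw [hγ]; exact continuous_const.mul (hι.comp (continuous_expMem_smul X))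
  have hγs : ∀ t, g * ι (H.expMem (t • X)) = γ t := fun t => by rw [hγ]
  -- the two integrands along the flow
  obtain ⟨F, hF⟩ : ∃ F : ℝ → ↥Y → ℂ, F = fun t (y : ↥Y) => f (((y : ↥Y) : GL (Fin n) (AdeleRing (𝓞 K) K)) * γ t) * χ y :=
    ⟨_, rfl⟩
  obtain ⟨F', hF'⟩ : ∃ F' : ℝ → ↥Y → ℂ, F' = fun t (y : ↥Y) => f' (((y : ↥Y) : GL (Fin n) (AdeleRing (𝓞 K) K)) * γ t) * χ y :=
    ⟨_, rfl⟩
  have hFe : ∀ t y, F t y = colIntegrand c hc hc0 f (γ t) y := fun t y => by rw [hF, hχ]; rfl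
  have hF'e : ∀ t y, F' t y = colIntegrand c hc hc0 f' (γ t) y := fun t y => by rw [hF', hχ]; rfl
  have hFc : Continuous fun p : ↥Y × ℝ => F p.2 p.1 := by
    rw [hF]
    exact (hf.comp ((continuous_subtype_val.comp continuous_fst).mul (hγc.comp continuous_snd))).mul
      (hχc.comp continuous_fst)
  have hF'c : Continuous fun p : ↥Y × ℝ => F' p.2 p.1 := by
    rw [hF']
    exact (hf'.comp ((continuous_subtype_val.comp continuous_fst).mul (hγc.comp continuous_snd))).mul
      (hχc.comp continuous_fst)
  -- uniform bounds on `closure box × closedBall s 1`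
  have hCc : IsCompact ((closure box) ×ˢ closedBall s 1) :=
    isCompact_closure_colRangeTateDomain.prod (isCompact_closedBall s 1)
  obtain ⟨M, hM⟩ := hCc.exists_bound_of_continuousOn hFc.continuousOn
  obtain ⟨M', hM'⟩ := hCc.exists_bound_of_continuousOn hF'c.continuousOn
  have hmeas : ∀ t : ℝ, AEStronglyMeasurable (F t) (μ.restrict box) := fun t =>
    (hFc.comp (continuous_id.prodMk continuous_const)).aestronglyMeasurable
  have hmeas' : ∀ t : ℝ, AEStronglyMeasurable (F' t) (μ.restrict box) := fun t =>
    (hF'c.comp (continuous_id.prodMk continuous_const)).aestronglyMeasurable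
  have hint : Integrable (F s) (μ.restrict box) := by
    refine (integrable_const (max M 0)).mono' (hmeas s) ?_
    rw [ae_restrict_iff' hboxm]
    exact Eventually.of_forall fun y hy =>
      (hM ⟨y, s⟩ ⟨subset_closure hy, mem_closedBall_self zero_le_one⟩).trans (le_max_left _ _)
  have hbound : ∀ᵐ y ∂(μ.restrict box), ∀ t ∈ ball s 1, ‖F' t y‖ ≤ max M' 0 := by
    rw [ae_restrict_iff' hboxm]
    exact Eventually.of_forall fun y hy t ht =>
      (hM' ⟨y, t⟩ ⟨subset_closure hy, ball_subset_closedBall ht⟩).trans (le_max_left _ _)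
  have hdiff : ∀ᵐ y ∂(μ.restrict box), ∀ t ∈ ball s 1, HasDerivAt (fun t => F t y) (F' t y) t := by
    refine Eventually.of_forall fun y t _ => ?_
    have h1 := (hasDerivAt_flow_of_hasDerivAt_zero ι X hflow ((y : GL (Fin n) (AdeleRing (𝓞 K) K)) * g) t).mul_const
      (χ y)
    have e : (fun t : ℝ => F t y) = fun t => f ((y : GL (Fin n) (AdeleRing (𝓞 K) K)) * g * ι (H.expMem (t • X))) * χ y := by
      funext t
      rw [hF, mul_assoc, hγs]
    have e' : F' t y = f' ((y : GL (Fin n) (AdeleRing (𝓞 K) K)) * g * ι (H.expMem (t • X))) * χ y := by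
      rw [hF', mul_assoc, hγs]
    rw [e, e']
    exact h1
  have h := hasDerivAt_integral_of_dominated_loc_of_deriv_le (μ := μ.restrict box) (x₀ := s)
    (F := F) (F' := F') (bound := fun _ => max M' 0) (ball_mem_nhds s one_pos)
    (Eventually.of_forall hmeas) hint (hmeas' s) hbound (integrable_const _) hdiff
  have h2 : HasDerivAt (fun t : ℝ => ∫ y in box, F t y ∂μ) (∫ y in box, F' s y ∂μ) s := h.2
  -- reinsert the normalisation
  have e : (fun t : ℝ => colTransform (K := K) c hc hc0 f (g * ι (H.expMem (t • X)))) =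
      fun t => ((μ box).toReal⁻¹ : ℝ) • ∫ y in box, F t y ∂μ := by
    funext t
    rw [colTransform_eq, hγs]
    simp_rw [hFe]
    rfl
  have e' : colTransform (K := K) c hc hc0 f' (g * ι (H.expMem (s • X))) =
      ((μ box).toReal⁻¹ : ℝ) • ∫ y in box, F' s y ∂μ := by
    rw [colTransform_eq, hγs]
    simp_rw [hF'e]
    rfl
  rw [e, e']
  exact h2.fun_const_smul _

/-- **Differentiation of the partial Whittaker transforms along an archimedean flow**: under the
hypotheses of `hasDerivAt_colTransform_flow`,
`d/dt (whittakerIter k f)(g ι(exp tX))|_{t=s} = (whittakerIter k f')(g ι(exp sX))` for every `k`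
(induction on the number of integrated columns). [cite: MoeglinWaldspurger1995, I.2.10] -/
theorem hasDerivAt_whittakerIter_flow (X : H.lie)
    {f f' : GL (Fin n) (AdeleRing (𝓞 K) K) → ℂ} (hf : Continuous f) (hf' : Continuous f')
    (hflow : ∀ z, HasDerivAt (fun t : ℝ => f (z * ι (H.expMem (t • X)))) (f' z) 0) :
    ∀ (k : ℕ) (g : GL (Fin n) (AdeleRing (𝓞 K) K)) (s : ℝ),
      HasDerivAt (fun t : ℝ => whittakerIter (K := K) k f (g * ι (H.expMem (t • X))))
        (whittakerIter (K := K) k f' (g * ι (H.expMem (s • X)))) s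
  | 0, g, s => hasDerivAt_flow_of_hasDerivAt_zero ι X hflow g s
  | k + 1, g, s => by
    by_cases h : n - (k + 1) < n ∧ 0 < n - (k + 1)
    · have e1 : whittakerIter (K := K) (k + 1) f = colTransform (n - (k + 1)) h.1 h.2 (whittakerIter k f) := by
        funext z; simp only [whittakerIter, dif_pos h]
      have e2 : whittakerIter (K := K) (k + 1) f' = colTransform (n - (k + 1)) h.1 h.2 (whittakerIter k f') := by
        funext z; simp only [whittakerIter, dif_pos h]
      rw [e1, e2]
      refine hasDerivAt_colTransform_flow ι hι _ h.1 h.2 X (continuous_whittakerIter hf k)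
        (continuous_whittakerIter hf' k) (fun z => ?_) g s
      have h0 := hasDerivAt_whittakerIter_flow X hf hf' hflow k z 0
      rwa [expMem_zero_smul'', map_one, mul_one] at h0
    · have e1 : whittakerIter (K := K) (k + 1) f = whittakerIter k f := by
        funext z; simp only [whittakerIter, dif_neg h]
      have e2 : whittakerIter (K := K) (k + 1) f' = whittakerIter k f' := by
        funext z; simp only [whittakerIter, dif_neg h]
      rw [e1, e2]
      exact hasDerivAt_whittakerIter_flow X hf hf' hflow k g s

/-- **Differentiation of `Φ_d` along an archimedean flow**:
`d/dt Φ_d(f)(g ι(exp tX))|_{t=s} = Φ_d(f')(g ι(exp sX))`. [cite: MoeglinWaldspurger1995, I.2.10] -/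
theorem hasDerivAt_whittakerDepth_flow (X : H.lie)
    {f f' : GL (Fin n) (AdeleRing (𝓞 K) K) → ℂ} (hf : Continuous f) (hf' : Continuous f')
    (hflow : ∀ z, HasDerivAt (fun t : ℝ => f (z * ι (H.expMem (t • X)))) (f' z) 0)
    (d : ℕ) (g : GL (Fin n) (AdeleRing (𝓞 K) K)) (s : ℝ) :
    HasDerivAt (fun t : ℝ => whittakerDepth (K := K) d f (g * ι (H.expMem (t • X))))
      (whittakerDepth (K := K) d f' (g * ι (H.expMem (s • X)))) s :=
  hasDerivAt_whittakerIter_flow ι hι X hf hf' hflow _ g s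

/-- **`X Φ_d(f) = Φ_d(f')`** when `f'` is the (continuous) flow derivative of the continuous `f`
along `X`. [cite: MoeglinWaldspurger1995, I.2.10] -/
theorem lieDeriv_whittakerDepth_of_hasDerivAt (X : H.lie)
    {f f' : GL (Fin n) (AdeleRing (𝓞 K) K) → ℂ} (hf : Continuous f) (hf' : Continuous f')
    (hflow : ∀ z, HasDerivAt (fun t : ℝ => f (z * ι (H.expMem (t • X)))) (f' z) 0) (d : ℕ) :
    lieDeriv ι X (whittakerDepth (K := K) d f) = whittakerDepth (K := K) d f' := by
  funext g
  have h := hasDerivAt_whittakerDepth_flow ι hι X hf hf' hflow d g 0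
  rw [expMem_zero_smul'', map_one, mul_one] at h
  exact h.deriv

/-- **`X Φ_d(φ) = Φ_d(X φ)`** for `φ` continuous and archimedean-smooth with continuous Lie
derivative `X φ` (`IsArchSmooth.hasDerivAt_flow_zero`). Moeglin–Waldspurger (1995), I.2.10;
Cogdell (2004), proof of Thm. 1.1. [cite: MoeglinWaldspurger1995, I.2.10] -/
theorem lieDeriv_whittakerDepth (X : H.lie) {φ : GL (Fin n) (AdeleRing (𝓞 K) K) → ℂ}
    (hφ : Continuous φ) (hφs : IsArchSmooth ι φ) (hφX : Continuous (lieDeriv ι X φ)) (d : ℕ) :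
    lieDeriv ι X (whittakerDepth (K := K) d φ) = whittakerDepth (K := K) d (lieDeriv ι X φ) :=
  lieDeriv_whittakerDepth_of_hasDerivAt ι hι X hφ hφX (fun z => hφs.hasDerivAt_flow_zero ι X z) d

/-- **Iterated Lie derivatives pass through the Whittaker tower**:
`(X₁ ⋯ X_k) Φ_d(φ) = Φ_d((X₁ ⋯ X_k) φ)` for `φ` all of whose iterated Lie derivatives are
archimedean-smooth and continuous (e.g. a cusp form of uniformly moderate growth).
[cite: MoeglinWaldspurger1995, I.2.10] -/
theorem iterLieDeriv_whittakerDepth {φ : GL (Fin n) (AdeleRing (𝓞 K) K) → ℂ}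
    (hs : ∀ l : List H.lie, IsArchSmooth ι (iterLieDeriv ι l φ))
    (hc : ∀ l : List H.lie, Continuous (iterLieDeriv ι l φ)) (d : ℕ) :
    ∀ w : List H.lie,
      iterLieDeriv ι w (whittakerDepth (K := K) d φ) = whittakerDepth (K := K) d (iterLieDeriv ι w φ)
  | [] => rfl
  | X :: w => by
    rw [iterLieDeriv_cons, iterLieDeriv_cons, iterLieDeriv_whittakerDepth hs hc d w]
    have h := hc (X :: w)
    rw [iterLieDeriv_cons] at h
    exact lieDeriv_whittakerDepth ι hι X (hc w) (hs w) h d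

/-- **Flow derivatives of all orders of `Φ_d` along `Y`**: for `φ` with archimedean-smooth,
continuous iterated Lie derivatives, the `k`-th derivative of `s ↦ Φ_d(φ)(g ι(exp sY))` is
`s ↦ Φ_d(Y^k φ)(g ι(exp sY))` (as functions). [cite: MoeglinWaldspurger1995, I.2.10] -/
theorem iterate_deriv_whittakerDepth_flow {φ : GL (Fin n) (AdeleRing (𝓞 K) K) → ℂ}
    (hs : ∀ l : List H.lie, IsArchSmooth ι (iterLieDeriv ι l φ))
    (hc : ∀ l : List H.lie, Continuous (iterLieDeriv ι l φ)) (d : ℕ) (Y : H.lie)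
    (g : GL (Fin n) (AdeleRing (𝓞 K) K)) :
    ∀ k : ℕ, deriv^[k] (fun s : ℝ => whittakerDepth (K := K) d φ (g * ι (H.expMem (s • Y)))) =
      fun s : ℝ => whittakerDepth (K := K) d (iterLieDeriv ι (List.replicate k Y) φ) (g * ι (H.expMem (s • Y)))
  | 0 => by simp
  | k + 1 => by
    rw [Function.iterate_succ', Function.comp_apply, iterate_deriv_whittakerDepth_flow hs hc d Y g k,
      List.replicate_succ, iterLieDeriv_cons]
    funext s
    have hck : Continuous (iterLieDeriv ι (List.replicate k Y) φ) := hc _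
    have hck' : Continuous (lieDeriv ι Y (iterLieDeriv ι (List.replicate k Y) φ)) := by
      have := hc (Y :: List.replicate k Y); rwa [iterLieDeriv_cons] at this
    exact (hasDerivAt_whittakerDepth_flow ι hι Y hck hck'
      (fun z => (hs _).hasDerivAt_flow_zero ι Y z) d g s).deriv

/-- **`(d/ds)^k Φ_d(φ)(g ι(exp sY))|_{s=0} = Φ_d(Y^k φ)(g)`.** [cite: MoeglinWaldspurger1995, I.2.10] -/
theorem iteratedDeriv_whittakerDepth_flow {φ : GL (Fin n) (AdeleRing (𝓞 K) K) → ℂ}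
    (hs : ∀ l : List H.lie, IsArchSmooth ι (iterLieDeriv ι l φ))
    (hc : ∀ l : List H.lie, Continuous (iterLieDeriv ι l φ)) (d : ℕ) (Y : H.lie)
    (g : GL (Fin n) (AdeleRing (𝓞 K) K)) (k : ℕ) :
    iteratedDeriv k (fun s : ℝ => whittakerDepth (K := K) d φ (g * ι (H.expMem (s • Y)))) 0 =
      whittakerDepth (K := K) d (iterLieDeriv ι (List.replicate k Y) φ) g := by
  rw [iteratedDeriv_eq_iterate, iterate_deriv_whittakerDepth_flow ι hι hs hc d Y g k]
  simp only [expMem_zero_smul'', map_one, mul_one]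

end Transform

end Literature.NumberTheory.Automorphic
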